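import Literature.Probability.Percolation.NearCriticalCorrelationLengthLower
import Literature.Probability.Percolation.TriLadder
import Mathlib.Analysis.SpecificLimits.Basic
import HarnessLib

/-!
# Finite clusters above `p_c`: the supercritical radius decay from white crossings

Topic `Literature/Probability/Percolation`; family `crit-perc`. Part of the bottom-up discharge of
`Literature.Probability.Percolation.triCorrLength_exponent` (`ArmExponents.lean`; decomposition in
`NearCriticalCorrelationLength.lean`, `NearCriticalCorrelationLengthLower.lean`). This file PROVES the
supercritical half `Nolin2008_radius_decay_supercritical_at ε` of the radius decay of the *finite*
open cluster of the origin (Nolin 2008, §7.5, proof of Lemma 44, second annulus display: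
`P_p(∂S_L ↝ ∂S_{kL}, |C(0)| < ∞) ≤ P_p(∃ white circuit …) ≤ C₅ e^{-C₆ k}`, `p > 1/2`) from Nolin's
Lemma 39 / Remark 40 at the dual parameter `1 - p < 1/2` (`Nolin2008_lemma39_at ε`, uniform
exponential decay of *white* crossings beyond `L_ε(1 - p) = L_ε(p)`), replacing the white
*circuit* of the printed argument (duality finite black cluster ⟺ surrounding white circuit,
Kesten 1982, Cor. 2.2) by a white *crossing* obtained from the Hex lemma (`tri_hex`,
`TriHexLemma.lean`) and the meeting of crossings (`PathIn.tri_crossings_meet`,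
`TriCrossingsMeet.lean`):

* (`triBoxExit_inter_triClusterIn_subset`) if the origin is joined inside `S_a` to the right side
  `{x₀ = a}` of `S_a` by open sites while its whole open cluster lies in `S_b`, `1 ≤ a ≤ b`, then
  the closed (white) sites cross the parallelogram `R = [0, a] × [-(b+1), b+1]` from left to right:
  by the Hex lemma applied to the white sites of `R`, the alternative is an open top–bottom
  crossing of `R`, which would meet (crossings of `R` meet) the open path from the column
  `{x₀ = 0}` to `{x₀ = a}` extracted from the arm, putting a site with `x₁ = b + 1` in the cluster
  of the origin — excluded. The three other sides follow by the symmetries `triNegIso`,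
  `triSwapIso` of `𝕋` (`triSitePercolation_real_triBoxExit_inter_triClusterIn_eq`).
* (`triBoxArm_inter_finite_subset_iUnion`) if `|C(0)| < ∞` and `0 ↝ ∂S_{kL}`, let `J ≥ k` be the
  largest multiple `JL` of `L ≥ 1` with `0 ↝ ∂S_{JL}`; then `C(0) ⊆ S_{(J+1)L - 1}`, so the
  previous item applies with `a = JL`, `b = (J+1)L - 1`, producing a white crossing of an
  `a × 2(J+1)L ⊆ a × 4a` parallelogram in the easy direction, of `P_p`-probability
  `P_{1-p}(LR_𝕋(a, 4a)) ≤ C₁ e^{-C₂ J}` by Lemma 39 (aspect ratio `4`) at `1 - p`.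
* Summing the geometric series over `J ≥ k` (`Nolin2008_radius_decay_supercritical_at_of_lemma39_at`):
  `P_p(0 ↝ ∂S_{kL}, |C(0)| < ∞) ≤ 4 C₁ (1 - e^{-C₂})⁻¹ e^{-C₂ k}` for *all* `p > 1/2` with
  `L_ε(p) ≥ 1`.

Consequently (`Nolin2008_radius_decay_at_of_lemma39_at'`, `triCorrLength_exponent_of_RSW_lemma39_at'`):
the named fact `triCorrLength_exponent` follows from `fourArm_exponent`, `Nolin2008_prop34`
(`KestenScaling.lean`), the Russo–Seymour–Welsh theorem `Nolin2008_RSW` and Nolin's Lemma 39 at one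
value `ε ∈ (0, 1/2)` — the supercritical leaf of `NearCriticalCorrelationLengthLower.lean` is
discharged.

## References

* P. Nolin, *Near-critical percolation in two dimensions*, Electron. J. Probab. 13 (2008), §2.2
  ("a white circuit surrounding `0`"), §7.4 Lemma 39 / Remark 40, §7.5 proof of Lemma 44
  (EJP numbering; arXiv 0711.4948: Lemma 37 / Remark 38, Lemma 42) [Nolin2008].
* H. Kesten, *Percolation theory for mathematicians* (1982), §2.2–2.3 (crossings of a
  parallelogram of a self-matching lattice meet), Cor. 2.2 [KestenPTM1982].
* B. Bollobás, O. Riordan, *Percolation* (2006), Ch. 5, Lemma 7 (Hex lemma) [BollobasRiordan2006].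

## Mathlib / tree

Mathlib: `measure_iUnion_le`, `ENNReal.ofReal_tsum_of_nonneg`, `tsum_geometric_of_lt_one`,
`Nat.findGreatest`; no percolation. Tree: `tri_hex` (`TriHexLemma.lean`),
`PathIn.tri_crossings_meet` (`TriCrossingsMeet.lean`), `PathIn.exists_slab_crossing`
(`TriPathCrossings.lean`), `PathIn.exists_support`,
`pathIn_shift`, `pathIn_map_iso`, `triHCross`, `triSitePercolation_real_triHCross`,
`triLRCrossingProb_mono_height`, `triNegIso` (`TriRSWChaining.lean`), `triBoxArm`, `triBoxExit`,
`triBoxArm_subset_union`, `preimage_relabel_triBoxExit`, `mem_triBoxArm_of_pathIn`,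
`mem_siteCluster_of_pathIn` (`TriLadder.lean`),
`Nolin2008_lemma39_at`, `Nolin2008_radius_decay_supercritical_at`
(`NearCriticalCorrelationLength.lean`), `triCorrLength_exponent_of_RSW_lemma39_at`
(`NearCriticalCorrelationLengthLower.lean`), `sitePercolation_real_preimage_compl`,
`sitePercolation_real_preimage_relabel`, `charLength_symm`.
-/

noncomputable section

open MeasureTheory Set Filter Topology
open scoped unitInterval ENNReal

namespace Literature.Probability.Percolation

open LatticeModels

/-! ### The open cluster of the origin confined to a rhombus -/

/-- The event that the open cluster of the origin (`siteCluster`) is contained in the rhombus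
`S_b = box 2 b`, i.e. every open path from the origin stays in `S_b` (Nolin 2008, §2.2: `|C(0)| < ∞` is
exhausted by the scales `S_n` containing `C(0)`). [folklore] -/
def triClusterIn (b : ℕ) : Set (SiteConfig (Site 2)) :=
  {ω | siteCluster triGraph ω 0 ⊆ ↑(box 2 b)}

/-- Membership in `triClusterIn` in terms of open paths from the origin
(`PathIn.of_mem_siteCluster`, `mem_siteCluster_of_pathIn`). [folklore] -/
theorem mem_triClusterIn_iff {b : ℕ} {ω : SiteConfig (Site 2)} :
    ω ∈ triClusterIn b ↔ ∀ y, PathIn triGraph ω 0 y → y ∈ box 2 b := by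
  constructor
  · intro h y hy
    exact Finset.mem_coe.1 (h (mem_siteCluster_of_pathIn hy))
  · intro h y hy
    exact Finset.mem_coe.2 (h y (PathIn.of_mem_siteCluster hy))

/-! ### A maximal arm to the right side forces a white crossing -/

/-- **White crossing next to a confined cluster** (the combinatorial core; Nolin 2008, §2.2 /
§7.5 use the surrounding white circuit of Kesten 1982, Cor. 2.2 — here a crossing suffices). If
the origin is joined to a site of the right side `{x₀ = a}` of `S_a` by open sites of `S_a`, and
every open path from the origin stays in `S_b` (`1 ≤ a ≤ b`), then the closed sites contain a
left–right crossing of the parallelogram `[0, a] × [-(b+1), b+1]`. Proof: by the Hex lemma for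
the closed sites of this parallelogram `R`, the alternative is an open top–bottom crossing of
`R`; it meets (`PathIn.tri_crossings_meet`) the piece in the slab `{0 ≤ x₀ ≤ a}`
(`PathIn.exists_slab_crossing`) of the open path from `0` to `{x₀ = a}`, so its top end, at height `b + 1`, is joined to `0` by open
sites — contradicting the confinement to `S_b`. [cite: Nolin2008, §2.2 and §7.5 (proof of Lemma 44 (arXiv: Lemma 42))] -/
theorem triBoxExit_inter_triClusterIn_subset {a b : ℕ} (ha : 1 ≤ a) (hab : a ≤ b) :
    triBoxExit a (fun y => y 0 = a) ∩ triClusterIn b ⊆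
      compl ⁻¹' triHCross 0 (-((b : ℤ) + 1)) a (2 * (b + 1)) := by
  rintro ω ⟨⟨z, hzbox, hz0, hconn⟩, hcl'⟩
  have hcl := mem_triClusterIn_iff.1 hcl'
  rw [Set.mem_preimage]
  -- the open path from `0` to `z` inside `S_a`, on a tight support `S`
  have hpath : PathIn triGraph (↑(box 2 a) ∩ ω) 0 z := PathIn.of_mem_siteConnIn hconn
  obtain ⟨S, hSsub, hSz, hS⟩ := hpath.exists_support
  have hSbox : ∀ w ∈ S, (-(a : ℤ) ≤ w 0 ∧ w 0 ≤ a) ∧ (-(a : ℤ) ≤ w 1 ∧ w 1 ≤ a) := fun w hw => by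
    have := (hSsub hw).1
    rw [Finset.mem_coe, mem_box] at this
    exact ⟨this 0, this 1⟩
  -- its piece in the slab `0 ≤ x₀ ≤ a`, from the column `{x₀ = 0}` to the column `{x₀ = a}`
  obtain ⟨x', z', hx'0, hz'0, hγ⟩ :=
    hSz.exists_slab_crossing 0 (L := 0) (R := a) (by positivity) (by simp) (by rw [hz0])
  -- the parallelogram `R = [0, a] × [-(b+1), b+1]` is `rectangle a (2(b+1))` translated by `-v`
  set v : Site 2 := ![(0 : ℤ), (b : ℤ) + 1] with hv
  have hv0 : v 0 = 0 := rfl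
  have hv1 : v 1 = (b : ℤ) + 1 := rfl
  rcases tri_hex a (2 * (b + 1)) ((· + v) '' ωᶜ) with ⟨x, hx, y, hy, hxy⟩ | ⟨x, hx, y, hy, hxy⟩
  · -- a white left-right crossing of `rectangle a (2(b+1))` in the shifted configuration
    rw [leftSide, Finset.mem_filter] at hx
    rw [rightSide, Finset.mem_filter] at hy
    have hAB : ∀ w ∈ (↑(rectangle a (2 * (b + 1))) : Set (Site 2)) ∩ (· + v) '' ωᶜ,
        w + -v ∈ triStrip 0 (-((b : ℤ) + 1)) a (2 * (b + 1)) ∩ ωᶜ := by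
      rintro w ⟨hw, ⟨u, hu, rfl⟩⟩
      rw [Finset.mem_coe, mem_rectangle_iff] at hw
      simp only [Pi.add_apply, hv0, hv1] at hw
      refine ⟨?_, by rwa [add_neg_cancel_right]⟩
      simp only [mem_triStrip, Pi.add_apply, Pi.neg_apply, hv0, hv1]
      push_cast at hw ⊢
      omega
    refine ⟨x + -v, y + -v, ?_, ?_, pathIn_shift (-v) hAB hxy⟩
    · simp only [Pi.add_apply, Pi.neg_apply, hv0]; omega
    · simp only [Pi.add_apply, Pi.neg_apply, hv0]; omega
  · -- an open top-bottom crossing of the shifted rectangle: impossible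
    exfalso
    rw [bottomSide, Finset.mem_filter] at hx
    rw [topSide, Finset.mem_filter] at hy
    -- shift it back to `R ∩ ω`
    have hAB : ∀ w ∈ (↑(rectangle a (2 * (b + 1))) : Set (Site 2)) ∩ ((· + v) '' ωᶜ)ᶜ,
        w + -v ∈ triStrip 0 (-((b : ℤ) + 1)) a (2 * (b + 1)) ∩ ω := by
      rintro w ⟨hw, hwc⟩
      rw [Finset.mem_coe, mem_rectangle_iff] at hw
      refine ⟨?_, ?_⟩
      · simp only [mem_triStrip, Pi.add_apply, Pi.neg_apply, hv0, hv1]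
        push_cast at hw ⊢
        omega
      · by_contra hwω
        exact hwc ⟨w + -v, hwω, by simp only [neg_add_cancel_right]⟩
    have hτ : PathIn triGraph (triStrip 0 (-((b : ℤ) + 1)) a (2 * (b + 1)) ∩ ω) (x + -v) (y + -v) :=
      pathIn_shift (-v) hAB hxy
    obtain ⟨S', hS'sub, hS'τ, hS'⟩ := hτ.exists_support
    -- the two crossings of `R` meet
    have hA : ∀ w ∈ S ∩ {w : Site 2 | (0 : ℤ) ≤ w 0 ∧ w 0 ≤ a},
        (0 : ℤ) ≤ w 0 ∧ w 0 ≤ a ∧ -((b : ℤ) + 1) ≤ w 1 ∧ w 1 ≤ (b : ℤ) + 1 := by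
      rintro w ⟨hwS, hw0⟩
      have := hSbox w hwS
      simp only [Set.mem_setOf_eq] at hw0
      omega
    have hA' : ∀ w ∈ S', (0 : ℤ) ≤ w 0 ∧ w 0 ≤ a ∧ -((b : ℤ) + 1) ≤ w 1 ∧ w 1 ≤ (b : ℤ) + 1 := by
      intro w hw
      have := (hS'sub hw).1
      simp only [mem_triStrip] at this
      push_cast at this
      omega
    obtain ⟨w, hwA, hwS'⟩ := PathIn.tri_crossings_meet hA hA' hγ hx'0 hz'0 hS'τ
      (by simp only [Pi.add_apply, Pi.neg_apply, hv1, hx.2]; ring)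
      (by simp only [Pi.add_apply, Pi.neg_apply, hv1, hy.2]; push_cast; ring)
    -- hence the top end of the open crossing is joined to `0` by open sites
    have h0w : PathIn triGraph ω 0 w :=
      (hS w hwA.1).mono fun u hu => (hSsub hu).2
    have hwd : PathIn triGraph ω w (y + -v) :=
      ((hS' w hwS').symm.trans hS'τ).mono fun u hu => (hS'sub hu).2
    have hmem := hcl _ (h0w.trans hwd)
    rw [mem_box] at hmem
    have := (hmem 1).2
    simp only [Pi.add_apply, Pi.neg_apply, hv1, hy.2] at this
    push_cast at this
    omega

/-! ### The other three sides, by symmetry -/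

/-- The confinement event is invariant under a symmetry of `𝕋` fixing `0` and the rhombi. [folklore] -/
theorem mem_triClusterIn_of_image {b : ℕ} (φ : triGraph ≃g triGraph)
    (hbox : ∀ y, φ y ∈ box 2 b ↔ y ∈ box 2 b) (h0 : φ 0 = 0) {ω : SiteConfig (Site 2)}
    (h : (φ '' ω) ∈ triClusterIn b) : ω ∈ triClusterIn b := by
  rw [mem_triClusterIn_iff] at h ⊢
  intro y hy
  have := pathIn_map_iso φ hy
  rw [h0] at this
  exact (hbox y).1 (h _ this)

/-- `φ⁻¹ '' (φ '' ω) = ω` for a symmetry `φ` of `𝕋`. [folklore] -/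
theorem iso_symm_image_image (φ : triGraph ≃g triGraph) (ω : Set (Site 2)) :
    φ.symm '' (φ '' ω) = ω := by
  rw [Set.image_image]
  convert Set.image_id ω
  exact φ.symm_apply_apply _

/-- Preimage form: relabelling by such a symmetry preserves the confinement event. [folklore] -/
theorem preimage_relabel_triClusterIn {b : ℕ} (φ : triGraph ≃g triGraph)
    (hbox : ∀ y, φ y ∈ box 2 b ↔ y ∈ box 2 b) (h0 : φ 0 = 0) :
    SiteConfig.relabel φ.toEquiv ⁻¹' triClusterIn b = triClusterIn b := by
  have hbox' : ∀ y, φ.symm y ∈ box 2 b ↔ y ∈ box 2 b := fun y => by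
    rw [← hbox, RelIso.apply_symm_apply]
  have h0' : φ.symm 0 = 0 := by
    rw [← h0, RelIso.symm_apply_apply, h0]
  ext ω
  rw [Set.mem_preimage, SiteConfig.relabel_apply]
  change (φ '' ω) ∈ triClusterIn b ↔ ω ∈ triClusterIn b
  refine ⟨mem_triClusterIn_of_image φ hbox h0, fun h => ?_⟩
  refine mem_triClusterIn_of_image φ.symm hbox' h0' ?_
  rwa [iso_symm_image_image]

/-- **Transport of the exit-and-confinement events** along a symmetry of `𝕋` fixing `0` and the
rhombi: `P_p(exit S_a through {P} ∩ C(0) ⊆ S_b) = P_p(exit S_a through {P'} ∩ C(0) ⊆ S_b)`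
when `P = P' ∘ φ`. [folklore] -/
theorem triSitePercolation_real_triBoxExit_inter_triClusterIn_iso (p : unitInterval) (a b : ℕ)
    (φ : triGraph ≃g triGraph) (hbox : ∀ N y, φ y ∈ box 2 N ↔ y ∈ box 2 N) (h0 : φ 0 = 0)
    {P P' : Site 2 → Prop} (hP : ∀ y, P' (φ y) ↔ P y) :
    (triSitePercolation p).real (triBoxExit a P ∩ triClusterIn b) =
      (triSitePercolation p).real (triBoxExit a P' ∩ triClusterIn b) := by
  unfold triSitePercolation
  rw [← sitePercolation_real_preimage_relabel φ.toEquiv p (triBoxExit a P' ∩ triClusterIn b),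
    Set.preimage_inter, preimage_relabel_triBoxExit a φ (hbox a) h0 hP,
    preimage_relabel_triClusterIn φ (hbox b) h0]

/-- The four exit-and-confinement events have the probability of the one through the right side. [folklore] -/
theorem triSitePercolation_real_triBoxExit_inter_triClusterIn_eq (p : unitInterval) (a b : ℕ) :
    (triSitePercolation p).real (triBoxExit a (fun y => y 0 = -a) ∩ triClusterIn b) =
        (triSitePercolation p).real (triBoxExit a (fun y => y 0 = a) ∩ triClusterIn b) ∧
      (triSitePercolation p).real (triBoxExit a (fun y => y 1 = a) ∩ triClusterIn b) =
        (triSitePercolation p).real (triBoxExit a (fun y => y 0 = a) ∩ triClusterIn b) ∧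
      (triSitePercolation p).real (triBoxExit a (fun y => y 1 = -a) ∩ triClusterIn b) =
        (triSitePercolation p).real (triBoxExit a (fun y => y 0 = a) ∩ triClusterIn b) := by
  have hneg : ∀ N (y : Site 2), triNegIso y ∈ box 2 N ↔ y ∈ box 2 N := fun N y => triNegIso_mem_box N y
  have hswap : ∀ N (y : Site 2), triSwapIso y ∈ box 2 N ↔ y ∈ box 2 N :=
    fun N y => triSwapIso_mem_box N y
  refine ⟨?_, ?_, ?_⟩
  · exact triSitePercolation_real_triBoxExit_inter_triClusterIn_iso p a b triNegIso hneg (by simp)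
      (P' := fun y => y 0 = a) fun y => by simp [neg_eq_iff_eq_neg]
  · exact triSitePercolation_real_triBoxExit_inter_triClusterIn_iso p a b triSwapIso hswap (by simp)
      (P' := fun y => y 0 = a) fun y => by simp
  · refine (triSitePercolation_real_triBoxExit_inter_triClusterIn_iso p a b triSwapIso hswap (by simp)
      (P' := fun y => y 0 = -(a : ℤ)) fun y => by simp).trans ?_
    exact triSitePercolation_real_triBoxExit_inter_triClusterIn_iso p a b triNegIso hneg (by simp)
      (P' := fun y => y 0 = a) fun y => by simp [neg_eq_iff_eq_neg]

/-- **Probability of an arm at scale `a` with the cluster confined to `S_b`** (`1 ≤ a ≤ b`): at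
most four times the `P_{1-p}`-probability of an open left–right crossing of `[0, a] × [0, 2(b+1)]`
(colour exchange `sitePercolation_real_preimage_compl` and translation invariance
`triSitePercolation_real_triHCross`). [cite: Nolin2008, §2.2 and §7.5 (proof of Lemma 44 (arXiv: Lemma 42))] -/
theorem triSitePercolation_real_triBoxArm_inter_triClusterIn_le (p : unitInterval) {a b : ℕ} (ha : 1 ≤ a)
    (hab : a ≤ b) :
    (triSitePercolation p).real (triBoxArm a ∩ triClusterIn b) ≤
      4 * triLRCrossingProb (σ p) a (2 * (b + 1)) := by
  obtain ⟨h1, h2, h3⟩ := triSitePercolation_real_triBoxExit_inter_triClusterIn_eq p a b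
  have hright : (triSitePercolation p).real (triBoxExit a (fun y => y 0 = a) ∩ triClusterIn b) ≤
      triLRCrossingProb (σ p) a (2 * (b + 1)) := by
    calc (triSitePercolation p).real (triBoxExit a (fun y => y 0 = a) ∩ triClusterIn b)
        ≤ (triSitePercolation p).real
            (compl ⁻¹' triHCross 0 (-((b : ℤ) + 1)) a (2 * (b + 1))) :=
          measureReal_mono (triBoxExit_inter_triClusterIn_subset ha hab) (measure_ne_top _ _)
      _ = (triSitePercolation (σ p)).real (triHCross 0 (-((b : ℤ) + 1)) a (2 * (b + 1))) := by
          unfold triSitePercolation; exact sitePercolation_real_preimage_compl p _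
      _ = triLRCrossingProb (σ p) a (2 * (b + 1)) := triSitePercolation_real_triHCross (σ p) 0 _ a _
  calc (triSitePercolation p).real (triBoxArm a ∩ triClusterIn b)
      ≤ (triSitePercolation p).real
          (((triBoxExit a (fun y => y 0 = a) ∩ triClusterIn b) ∪
              (triBoxExit a (fun y => y 0 = -a) ∩ triClusterIn b)) ∪
            ((triBoxExit a (fun y => y 1 = a) ∩ triClusterIn b) ∪
              (triBoxExit a (fun y => y 1 = -a) ∩ triClusterIn b))) := by
        refine measureReal_mono ?_ (measure_ne_top _ _)
        rintro ω ⟨harm, hcl⟩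
        rcases triBoxArm_subset_union a harm with (h | h) | (h | h)
        · exact Or.inl (Or.inl ⟨h, hcl⟩)
        · exact Or.inl (Or.inr ⟨h, hcl⟩)
        · exact Or.inr (Or.inl ⟨h, hcl⟩)
        · exact Or.inr (Or.inr ⟨h, hcl⟩)
    _ ≤ ((triSitePercolation p).real (triBoxExit a (fun y => y 0 = a) ∩ triClusterIn b) +
          (triSitePercolation p).real (triBoxExit a (fun y => y 0 = -a) ∩ triClusterIn b)) +
        ((triSitePercolation p).real (triBoxExit a (fun y => y 1 = a) ∩ triClusterIn b) +
          (triSitePercolation p).real (triBoxExit a (fun y => y 1 = -a) ∩ triClusterIn b)) :=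
        (measureReal_union_le _ _).trans (add_le_add (measureReal_union_le _ _)
          (measureReal_union_le _ _))
    _ ≤ 4 * triLRCrossingProb (σ p) a (2 * (b + 1)) := by rw [h1, h2, h3]; linarith

/-! ### The largest scale reached by a finite cluster -/

/-- **Covering of `{0 ↝ ∂S_{kL}, |C(0)| < ∞}` by the maximal scales** (`L ≥ 1`): if the open
cluster of the origin is finite and reaches `∂S_{kL}`, and `J ≥ k` is the largest integer with
`0 ↝ ∂S_{JL}`, then `0 ↝ ∂S_{JL}` while every open path from `0` stays in `S_{(J+1)L - 1}`.
(Nolin 2008, §2.2: the scales `S_n` exhaust the finite cluster.) [cite: Nolin2008, §2.2] -/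
theorem triBoxArm_inter_finite_subset_iUnion {L : ℕ} (k : ℕ) (hL : 1 ≤ L) :
    triBoxArm (k * L) ∩ (sitePercolatesAt triGraph 0)ᶜ ⊆
      ⋃ i : ℕ, triBoxArm ((k + i) * L) ∩ triClusterIn ((k + i + 1) * L - 1) := by
  classical
  rintro ω ⟨harm, hfin⟩
  have hfin' : (siteCluster triGraph ω 0).Finite := Set.not_infinite.1 hfin
  -- a bound `M` on the sup norm of the cluster
  obtain ⟨M, hM⟩ : ∃ M : ℕ, ∀ y ∈ siteCluster triGraph ω 0, ∀ i, |y i| ≤ M := by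
    obtain ⟨M, hM⟩ := (hfin'.image fun y : Site 2 => (max |y 0| |y 1|).toNat).bddAbove
    refine ⟨M, fun y hy i => ?_⟩
    have h := hM (Set.mem_image_of_mem _ hy)
    have h' : max |y 0| |y 1| ≤ (M : ℤ) := by
      have := Int.self_le_toNat (max |y 0| |y 1|)
      omega
    fin_cases i
    · exact (le_max_left _ _).trans h'
    · exact (le_max_right _ _).trans h'
  -- every scale `j L` reached by the cluster satisfies `j ≤ M`
  have hbound : ∀ j : ℕ, ω ∈ triBoxArm (j * L) → j ≤ M := by
    intro j hj
    obtain ⟨y, -, ⟨i, hi⟩, hω⟩ := mem_triBoxArm_iff.1 hj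
    have hy : y ∈ siteCluster triGraph ω 0 :=
      mem_siteCluster_of_pathIn ((PathIn.of_mem_siteConnIn hω).mono Set.inter_subset_right)
    have h1 := hM y hy i
    rw [hi] at h1
    have h2 : (j : ℤ) * L ≤ M := by exact_mod_cast h1
    have h3 : (j : ℤ) ≤ j * L := by
      have : (1 : ℤ) ≤ L := by exact_mod_cast hL
      nlinarith
    exact_mod_cast h3.trans h2
  -- the largest such scale `J ≥ k`
  set Q : ℕ → Prop := fun j => ω ∈ triBoxArm (j * L) with hQ
  set J := Nat.findGreatest Q M with hJ
  have hkM : k ≤ M := hbound k harm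
  have hJarm : ω ∈ triBoxArm (J * L) := Nat.findGreatest_spec (P := Q) hkM harm
  have hkJ : k ≤ J := Nat.le_findGreatest (P := Q) hkM harm
  have hJ1 : ω ∉ triBoxArm ((J + 1) * L) := by
    intro h
    have h1 : J + 1 ≤ M := hbound _ h
    exact Nat.findGreatest_is_greatest (P := Q) (Nat.lt_succ_self J) h1 h
  -- membership in the `(J - k)`-th set of the union
  refine Set.mem_iUnion.2 ⟨J - k, ?_, ?_⟩
  · rwa [Nat.add_sub_cancel' hkJ]
  · rw [Nat.add_sub_cancel' hkJ, mem_triClusterIn_iff]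
    intro y hy
    by_contra hyb
    rw [mem_box, not_forall] at hyb
    obtain ⟨i, hi⟩ := hyb
    refine hJ1 (mem_triBoxArm_of_pathIn hy ?_ ⟨i, ?_⟩)
    · exact le_trans hL (Nat.le_mul_of_pos_left L (Nat.succ_pos J))
    · rw [not_and_or, not_le, not_le] at hi
      have hcast : (((J + 1) * L - 1 : ℕ) : ℤ) = ((J : ℤ) + 1) * L - 1 := by
        have : 1 ≤ (J + 1) * L := le_trans hL (Nat.le_mul_of_pos_left L (Nat.succ_pos J))
        push_cast [Nat.cast_sub this]
        ring
      rw [hcast] at hi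
      rw [le_abs]
      push_cast
      rcases hi with hi | hi
      · right; linarith
      · left; linarith

/-! ### Summation: the supercritical radius decay from Lemma 39 -/

/-- A geometric tail bound in `ℝ≥0∞`: if `μ (E i) ≤ A r^i` (`A ≥ 0`, `0 ≤ r < 1`) then
`μ (⋃ i, E i) ≤ A / (1 - r)`, as a real inequality. [folklore] -/
theorem measureReal_iUnion_le_of_geometric {α : Type*} [MeasurableSpace α] (μ : Measure α)
    [IsFiniteMeasure μ] (E : ℕ → Set α) {A r : ℝ} (hA : 0 ≤ A) (hr0 : 0 ≤ r) (hr1 : r < 1)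
    (h : ∀ i, μ.real (E i) ≤ A * r ^ i) : μ.real (⋃ i, E i) ≤ A / (1 - r) := by
  have hsum : Summable fun i : ℕ => A * r ^ i := (summable_geometric_of_lt_one hr0 hr1).mul_left A
  have htsum : ∑' i : ℕ, A * r ^ i = A / (1 - r) := by
    rw [tsum_mul_left, tsum_geometric_of_lt_one hr0 hr1, div_eq_mul_inv]
  have hle : μ (⋃ i, E i) ≤ ENNReal.ofReal (A / (1 - r)) := by
    calc μ (⋃ i, E i) ≤ ∑' i, μ (E i) := measure_iUnion_le E
      _ ≤ ∑' i, ENNReal.ofReal (A * r ^ i) := by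
          refine ENNReal.tsum_le_tsum fun i => ?_
          rw [← ofReal_measureReal]
          exact ENNReal.ofReal_le_ofReal (h i)
      _ = ENNReal.ofReal (∑' i, A * r ^ i) :=
          (ENNReal.ofReal_tsum_of_nonneg (fun i => by positivity) hsum).symm
      _ = ENNReal.ofReal (A / (1 - r)) := by rw [htsum]
  have hnn : 0 ≤ A / (1 - r) := div_nonneg hA (by linarith)
  exact ENNReal.toReal_le_of_le_ofReal hnn hle

/-- **Lemma 39 ⟹ the supercritical radius decay** (Nolin 2008, §7.5, proof of Lemma 44, second
annulus display, here via white crossings): for every `p > 1/2` with `L = L_ε(p) ≥ 1` and every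
`k ≥ 1`, `P_p(0 ↝ ∂S_{kL}, |C(0)| < ∞) ≤ 4 C₁ (1 - e^{-C₂})⁻¹ e^{-C₂ k}`, where `C₁, C₂` are the
constants of `Nolin2008_lemma39_at ε` for the aspect ratio `4`, applied at the dual parameter
`1 - p < 1/2` (`L_ε(1 - p) = L_ε(p)`, `charLength_symm`). [cite: Nolin2008, §7.5 (proof of Lemma 44 (arXiv: Lemma 42)), §7.4 Lemma 39 / Remark 40 (arXiv: Lemma 37 / Remark 38)] -/
theorem Nolin2008_radius_decay_supercritical_at_of_lemma39_at {ε : ℝ}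
    (h37 : Nolin2008_lemma39_at ε) : Nolin2008_radius_decay_supercritical_at ε := by
  obtain ⟨C₁, hC₁, C₂, hC₂, h4⟩ := h37 4 (by norm_num)
  set r : ℝ := Real.exp (-C₂) with hr
  have hr0 : 0 ≤ r := (Real.exp_pos _).le
  have hr1 : r < 1 := Real.exp_lt_one_iff.2 (by linarith)
  refine ⟨1, one_pos, 4 * C₁ / (1 - r), div_pos (by linarith) (by linarith), C₂, hC₂, ?_⟩
  intro p hp _ hL k hk
  set L := charLength ε p with hLdef
  -- the dual parameter
  have hq : ((σ p : unitInterval) : ℝ) < 1 / 2 := by rw [unitInterval.coe_symm_eq]; linarith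
  have hLq : charLength ε (σ p) = L := charLength_symm ε p
  -- the bound at each maximal scale `J = k + i`
  have hscale : ∀ i : ℕ,
      (triSitePercolation p).real (triBoxArm ((k + i) * L) ∩ triClusterIn ((k + i + 1) * L - 1)) ≤
        (4 * C₁ * Real.exp (-(C₂ * k))) * r ^ i := by
    intro i
    set J := k + i with hJ
    have hJ1 : 1 ≤ J := le_trans hk (Nat.le_add_right k i)
    have hJL : 1 ≤ J * L := le_trans hL (Nat.le_mul_of_pos_left L (by omega))
    have ha : 1 ≤ J * L := hJL
    have hb1 : (J + 1) * L - 1 + 1 = (J + 1) * L :=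
      Nat.sub_add_cancel (le_trans hL (Nat.le_mul_of_pos_left L (Nat.succ_pos J)))
    have hab : J * L ≤ (J + 1) * L - 1 := by
      have : J * L + L = (J + 1) * L := by ring
      omega
    calc (triSitePercolation p).real (triBoxArm (J * L) ∩ triClusterIn ((J + 1) * L - 1))
        ≤ 4 * triLRCrossingProb (σ p) (J * L) (2 * ((J + 1) * L - 1 + 1)) :=
          triSitePercolation_real_triBoxArm_inter_triClusterIn_le p ha hab
      _ ≤ 4 * triLRCrossingProb (σ p) (J * L) (4 * (J * L)) := by
          rw [hb1]
          refine mul_le_mul_of_nonneg_left (triLRCrossingProb_mono_height _ _ ?_) (by norm_num)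
          nlinarith
      _ ≤ 4 * (C₁ * Real.exp (-(C₂ * (J * L : ℕ) / charLength ε (σ p)))) :=
          mul_le_mul_of_nonneg_left (h4 (σ p) hq (by rw [hLq]; exact hL) (J * L)) (by norm_num)
      _ = (4 * C₁ * Real.exp (-(C₂ * k))) * r ^ i := by
          have hL0 : (L : ℝ) ≠ 0 := by
            have : (1 : ℝ) ≤ L := by exact_mod_cast hL
            linarith
          have hexp : Real.exp (-(C₂ * ((J * L : ℕ) : ℝ) / (L : ℝ))) =
              Real.exp (-(C₂ * k)) * r ^ i := by
            rw [hr, ← Real.exp_nat_mul, ← Real.exp_add]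
            congr 1
            rw [hJ]
            push_cast
            field_simp
            ring
          rw [hLq, hexp]; ring
  -- sum the geometric series
  have hA : 0 ≤ 4 * C₁ * Real.exp (-(C₂ * k)) := by positivity
  have := measureReal_iUnion_le_of_geometric (triSitePercolation p)
    (fun i => triBoxArm ((k + i) * L) ∩ triClusterIn ((k + i + 1) * L - 1)) hA hr0 hr1 hscale
  calc (triSitePercolation p).real (triBoxArm (k * L) ∩ (sitePercolatesAt triGraph 0)ᶜ)
      ≤ (triSitePercolation p).real
          (⋃ i : ℕ, triBoxArm ((k + i) * L) ∩ triClusterIn ((k + i + 1) * L - 1)) :=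
        measureReal_mono (triBoxArm_inter_finite_subset_iUnion k hL) (measure_ne_top _ _)
    _ ≤ 4 * C₁ * Real.exp (-(C₂ * k)) / (1 - r) := this
    _ = 4 * C₁ / (1 - r) * Real.exp (-(C₂ * k)) := by ring

/-- **The radius decay beyond `L_ε` from Lemma 39 alone**: both halves of
`Nolin2008_radius_decay_at ε` follow from `Nolin2008_lemma39_at ε` (the subcritical half is
`Nolin2008_radius_decay_subcritical_at_of_lemma39_at`, `NearCriticalCorrelationLength.lean`). [cite: Nolin2008, §7.5 (proof of Lemma 44 (arXiv: Lemma 42)), §7.4 Lemma 39 / Remark 40 (arXiv: Lemma 37 / Remark 38)] -/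
theorem Nolin2008_radius_decay_at_of_lemma39_at' {ε : ℝ} (h37 : Nolin2008_lemma39_at ε) :
    Nolin2008_radius_decay_at ε :=
  Nolin2008_radius_decay_at_of_lemma39_at h37
    (Nolin2008_radius_decay_supercritical_at_of_lemma39_at h37)

/-- **`ν = 4/3` from four named inputs.** The correlation-length exponent
`triCorrLength_exponent` (`ξ(p) = |p - 1/2|^{-4/3 + o(1)}`) follows from the four-arm exponent
`fourArm_exponent`, Kesten's relation `Nolin2008_prop34`, the Russo–Seymour–Welsh theorem
`Nolin2008_RSW` and Nolin's uniform exponential decay `Nolin2008_lemma39_at ε` at a single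
`ε ∈ (0, 1/2)`. [cite: Nolin2008, §7.2 Thm. "Critical exponents" (arXiv: Thm. 31), §7.4 Lemma 39 (arXiv: Lemma 37), §7.5 (proof of Lemma 44 (arXiv: Lemma 42))] -/
theorem triCorrLength_exponent_of_RSW_lemma39_at' (h₄ : fourArm_exponent) (hK : Nolin2008_prop34)
    (hRSW : Nolin2008_RSW) {ε : ℝ} (hε : 0 < ε) (hε' : ε < 1 / 2) (h37 : Nolin2008_lemma39_at ε) :
    triCorrLength_exponent :=
  triCorrLength_exponent_of_RSW_lemma39_at h₄ hK hRSW hε hε' h37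
    (Nolin2008_radius_decay_supercritical_at_of_lemma39_at h37)

end Literature.Probability.Percolation
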